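import Summits.NavierStokesRegularity.FluidComputer.PalasekTowerTinyHosts

/-!
# The germ host, XVI: LARGE CARRIERS — the weak (hence tolerant) slot holds a flat blob of EVERY size,
# its readouts parked on a mirror pair of half-amplitude tiny decorations

Cell `ns-blowup`, seat `ns-blowup-ecbridge-3` (g3); GROUP C «BRIDGE SUPPORT» of the route
`PalasekTowerBreakdown` (crux `EpisodeBaseG`, item stmt-NavierStokesRegularity-19179, R2 of record).
Over ecbridge-4's `PalasekTowerTinyHosts.lean` (p452553: the tiny flat even blob `tinyProfile a = Y₀•B_a`
fills the WEAK slot for `a ≤ 5/256`) and `PalasekTowerGermHostPushed.lean` (p447736: every weak-slot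
profile is a prepared host); XV (`LevelZeroDataWeak.tol`). LABEL: E–C typing (KERNEL construction:
three definitions with body and their calculus; everything proved). WHAT THIS IS NOT: not
Navier–Stokes evidence — PRESCRIBED level-`0` profiles; a lone viscous vortex blob does not raise its
speed maximum by the factor `Y₁/Y₀` the episode asks, so `FirstEpisodeD` is presumably FALSE for every
member of this family; nothing about the flow after `τ₀`, `RungG 1` or blow-up.

## The point: READOUTS AND CARRIER DECOUPLE BY SYMMETRY

The slots tie the profile's SIZE to the register's small-scale readouts (strain `A₀ = N₀Y₀`, an
`N₀`-core loop at scale `1/N₀`) only if ONE blob must do everything — which is why the fillers of record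
are tiny (`a ≤ 5/256`). Park the readouts instead on a MIRROR PAIR of HALF-AMPLITUDE tiny blobs
`(Y₀/2)•B_a(· ∓ p)`, `p = (2b+1)e₁`, far from a carrier `Y₀•B_b` of ARBITRARY size `b > 0`:

  `decoratedBlob b a = tinyProfile b + mirrorDecor a b`,
  `mirrorDecor a b y = ½ (tinyProfile a (y − p) + tinyProfile a (y + p))`.

The whole profile is EVEN about `0` and FLAT there (the decorations vanish near `0`), its speed maximum
`Y₀` is attained ONLY at `0` (the decorations carry speed `≤ Y₀/2`), so the anchor test value at the
argmax is EXACTLY `0` (`accel_eq_zero_of_even_flat`, ecbridge-4) — the WEAK test holds with no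
far-field estimate at all; the strain floor and the core loop (winding `m = ⌈1/(32a)⌉`, twice
ecbridge-4's, to pay for the half amplitude) are read off the decoration at `+p` (§2: `anchor_decoratedBlob`, `strain_decoratedBlob`,
`core_decoratedBlob`, ceiling / argmax / support / divergence). The sequel
`PalasekTowerGermHostDecoratedSlot.lean` concludes `LevelZeroDataWeak (decoratedBlob b a) (2b + 2)` for
EVERY `b > 0` — carriers of Reynolds number `∼ Y₀ b` as large as desired — hence (ecbridge-4, XV) a
pinned rigid quiet prepared host in the singleton class of its pushed germ schedule.

References: S. Palasek, arXiv:2605.13827 §3.3 [cite: Palasek2026ElementaryModel, §3.3]; A. J. Majda,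
A. L. Bertozzi, *Vorticity and Incompressible Flow* (CUP 2002), §1.8 Prop. 1.16
[cite: MajdaBertozziCUP2002, §1.8 Prop. 1.16].
-/

noncomputable section

namespace Summit.NavierStokesRegularity.FluidComputer.PalasekTowerClayBridge.Germ

open Set Function Filter Topology InnerProductSpace Metric MeasureTheory Real
open scoped Topology ContDiff RealInnerProductSpace Laplacian

open Literature.Analysis.FluidPDE TinyBlob

/-! ## §1 Translates of the tiny profile -/

section Translate

variable {a : ℝ} {p : EuclideanSpace ℝ (Fin 3)}

/-- The derivative of a translate. [folklore] -/
theorem hasFDerivAt_tinyProfile_comp_sub (a : ℝ) (p y : EuclideanSpace ℝ (Fin 3)) :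
    HasFDerivAt (fun z => tinyProfile a (z - p)) (fderiv ℝ (tinyProfile a) (y - p)) y := by
  have hd : Differentiable ℝ (tinyProfile a) := (contDiff_tinyProfile a).differentiable (by simp)
  have h := (hd (y - p)).hasFDerivAt.comp y ((hasFDerivAt_id y).sub_const p)
  rw [ContinuousLinearMap.comp_id] at h
  exact h

/-- The derivative of a translate. [folklore] -/
theorem hasFDerivAt_tinyProfile_comp_add (a : ℝ) (p y : EuclideanSpace ℝ (Fin 3)) :
    HasFDerivAt (fun z => tinyProfile a (z + p)) (fderiv ℝ (tinyProfile a) (y + p)) y := by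
  have hd : Differentiable ℝ (tinyProfile a) := (contDiff_tinyProfile a).differentiable (by simp)
  have h := (hd (y + p)).hasFDerivAt.comp y ((hasFDerivAt_id y).add_const p)
  rw [ContinuousLinearMap.comp_id] at h
  exact h

/-- The Jacobian of a translate. [folklore] -/
theorem fderiv_tinyProfile_comp_sub (a : ℝ) (p y : EuclideanSpace ℝ (Fin 3)) :
    fderiv ℝ (fun z => tinyProfile a (z - p)) y = fderiv ℝ (tinyProfile a) (y - p) :=
  (hasFDerivAt_tinyProfile_comp_sub a p y).fderiv

/-- A translate is smooth. [folklore] -/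
theorem contDiff_tinyProfile_comp_sub (a : ℝ) (p : EuclideanSpace ℝ (Fin 3)) :
    ContDiff ℝ ∞ (fun z => tinyProfile a (z - p)) :=
  (contDiff_tinyProfile a).comp (contDiff_id.sub contDiff_const)

/-- A translate is smooth. [folklore] -/
theorem contDiff_tinyProfile_comp_add (a : ℝ) (p : EuclideanSpace ℝ (Fin 3)) :
    ContDiff ℝ ∞ (fun z => tinyProfile a (z + p)) :=
  (contDiff_tinyProfile a).comp (contDiff_id.add contDiff_const)

/-- `‖DU_a(a y₁)‖ = Y₀ κ₁ / a` at the scaled strain point. [folklore] -/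
theorem norm_fderiv_tinyProfile_strainPt (ha : 0 < a) :
    ‖fderiv ℝ (tinyProfile a) (a • strainPt)‖ = TowerRates.wide.Y 0 * (strainConst / a) := by
  rw [fderiv_tinyProfile, norm_smul, Real.norm_eq_abs, abs_of_pos (TowerRates.Y_pos _ _),
    norm_fderiv_tinyBlob_strainPt ha]

end Translate

/-! ## §2 The decorated blob -/

/-- **The decoration centre** `p = (2b + 1) e₁`. [folklore] -/
def decorCenter (b : ℝ) : EuclideanSpace ℝ (Fin 3) := (2 * b + 1) • e₁

/-- **The mirror decoration** `½ (U_a(y − p) + U_a(y + p))`. [folklore] -/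
def mirrorDecor (a b : ℝ) (y : EuclideanSpace ℝ (Fin 3)) : EuclideanSpace ℝ (Fin 3) :=
  (1 / 2 : ℝ) • (tinyProfile a (y - decorCenter b) + tinyProfile a (y + decorCenter b))

/-- **THE DECORATED BLOB** `Y₀•B_b + mirror decoration`. [folklore] -/
def decoratedBlob (b a : ℝ) (y : EuclideanSpace ℝ (Fin 3)) : EuclideanSpace ℝ (Fin 3) :=
  tinyProfile b y + mirrorDecor a b y

section Blob

variable {a b : ℝ}

/-- `‖p‖ = 2b + 1` (`b ≥ 0`). [folklore] -/
theorem norm_decorCenter (hb : 0 ≤ b) : ‖decorCenter b‖ = 2 * b + 1 := by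
  rw [decorCenter, norm_smul, show ‖e₁‖ = 1 by simp [e₁], mul_one, Real.norm_eq_abs,
    abs_of_nonneg (by linarith)]

/-- Near the origin (`‖y‖ ≤ 2b + 1/2`) both decorations vanish (`a ≤ 5/256`). [folklore] -/
theorem mirrorDecor_eq_zero_of_norm_le (hb : 0 ≤ b) (ha : 0 < a) (h5 : a ≤ 5 / 256)
    {y : EuclideanSpace ℝ (Fin 3)} (hy : ‖y‖ ≤ 2 * b + 1 / 2) : mirrorDecor a b y = 0 := by
  have hp := norm_decorCenter hb
  have h1 : 2 * a < ‖y - decorCenter b‖ := by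
    have := norm_sub_norm_le (decorCenter b) y
    rw [norm_sub_rev] at this
    linarith
  have h2 : 2 * a < ‖y + decorCenter b‖ := by
    have h3 := norm_sub_le (y + decorCenter b) y
    rw [add_sub_cancel_left] at h3
    linarith
  rw [mirrorDecor, tinyProfile_eq_zero_of_norm_gt ha h1, tinyProfile_eq_zero_of_norm_gt ha h2,
    add_zero, smul_zero]

/-- Away from the origin (`‖y‖ > 2b`) the carrier vanishes. [folklore] -/
theorem tinyProfile_eq_zero_of_lt (hb : 0 < b) {y : EuclideanSpace ℝ (Fin 3)} (hy : 2 * b < ‖y‖) :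
    tinyProfile b y = 0 :=
  tinyProfile_eq_zero_of_norm_gt hb hy

/-- Near `+p` (`‖y − p‖ ≤ 1/2`): the carrier and the `−p` decoration vanish. [folklore] -/
theorem decoratedBlob_of_near_plus (hb : 0 < b) (ha : 0 < a) (h5 : a ≤ 5 / 256)
    {y : EuclideanSpace ℝ (Fin 3)} (hy : ‖y - decorCenter b‖ ≤ 1 / 2) :
    decoratedBlob b a y = (1 / 2 : ℝ) • tinyProfile a (y - decorCenter b) := by
  have hp := norm_decorCenter hb.le
  have h1 : 2 * b < ‖y‖ := by
    have := norm_sub_norm_le (decorCenter b) (decorCenter b - y)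
    rw [sub_sub_cancel, norm_sub_rev] at this
    linarith
  have h2 : 2 * a < ‖y + decorCenter b‖ := by
    have h3 : ‖(2 : ℝ) • decorCenter b‖ ≤ ‖y + decorCenter b‖ + ‖y - decorCenter b‖ := by
      have := norm_sub_le (y + decorCenter b) (y - decorCenter b)
      rw [show y + decorCenter b - (y - decorCenter b) = (2 : ℝ) • decorCenter b by
        rw [two_smul]; abel] at this
      exact this
    rw [norm_smul, Real.norm_eq_abs, abs_of_pos two_pos, hp] at h3
    linarith
  rw [decoratedBlob, tinyProfile_eq_zero_of_lt hb h1, zero_add, mirrorDecor,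
    tinyProfile_eq_zero_of_norm_gt ha h2, add_zero]

/-- Near `−p` (`‖y + p‖ ≤ 1/2`): the carrier and the `+p` decoration vanish. [folklore] -/
theorem decoratedBlob_of_near_minus (hb : 0 < b) (ha : 0 < a) (h5 : a ≤ 5 / 256)
    {y : EuclideanSpace ℝ (Fin 3)} (hy : ‖y + decorCenter b‖ ≤ 1 / 2) :
    decoratedBlob b a y = (1 / 2 : ℝ) • tinyProfile a (y + decorCenter b) := by
  have hp := norm_decorCenter hb.le
  have h1 : 2 * b < ‖y‖ := by
    have h3 := norm_add_le (y + decorCenter b) (-y)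
    rw [show y + decorCenter b + -y = decorCenter b by abel, norm_neg] at h3
    linarith
  have h2 : 2 * a < ‖y - decorCenter b‖ := by
    have h3 : ‖(2 : ℝ) • decorCenter b‖ ≤ ‖y + decorCenter b‖ + ‖y - decorCenter b‖ := by
      have := norm_sub_le (y + decorCenter b) (y - decorCenter b)
      rw [show y + decorCenter b - (y - decorCenter b) = (2 : ℝ) • decorCenter b by
        rw [two_smul]; abel] at this
      exact this
    rw [norm_smul, Real.norm_eq_abs, abs_of_pos two_pos, hp] at h3
    linarith
  rw [decoratedBlob, tinyProfile_eq_zero_of_lt hb h1, zero_add, mirrorDecor,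
    tinyProfile_eq_zero_of_norm_gt ha h2, zero_add]

/-- The three regimes exhaust space: if `y` is `1/2`-far from both `±p` then the decoration vanishes
at `y`. [folklore] -/
theorem mirrorDecor_eq_zero_of_far (ha : 0 < a) (h5 : a ≤ 5 / 256) {y : EuclideanSpace ℝ (Fin 3)}
    (hplus : 1 / 2 < ‖y - decorCenter b‖) (hminus : 1 / 2 < ‖y + decorCenter b‖) : mirrorDecor a b y = 0 := by
  rw [mirrorDecor, tinyProfile_eq_zero_of_norm_gt ha (by linarith),
    tinyProfile_eq_zero_of_norm_gt ha (by linarith), add_zero, smul_zero]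

/-- `U` is smooth. [folklore] -/
theorem contDiff_decoratedBlob (b a : ℝ) : ContDiff ℝ ∞ (decoratedBlob b a) := by
  show ContDiff ℝ ∞ fun y => tinyProfile b y +
    (1 / 2 : ℝ) • (tinyProfile a (y - decorCenter b) + tinyProfile a (y + decorCenter b))
  exact (contDiff_tinyProfile b).add
    (((contDiff_tinyProfile_comp_sub a _).add (contDiff_tinyProfile_comp_add a _)).const_smul
      (1 / 2 : ℝ))

/-- `U` is divergence free. [folklore] -/
theorem isDivFree_decoratedBlob (hb : b ≠ 0) (ha : a ≠ 0) :
    VectorCalculus.IsDivFree (decoratedBlob b a) := by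
  intro y
  have hd : Differentiable ℝ (tinyProfile b) := (contDiff_tinyProfile b).differentiable (by simp)
  have H : HasFDerivAt (decoratedBlob b a) (fderiv ℝ (tinyProfile b) y +
      (1 / 2 : ℝ) • (fderiv ℝ (tinyProfile a) (y - decorCenter b) +
        fderiv ℝ (tinyProfile a) (y + decorCenter b))) y :=
    (hd y).hasFDerivAt.add (((hasFDerivAt_tinyProfile_comp_sub a _ y).add
      (hasFDerivAt_tinyProfile_comp_add a _ y)).const_smul (1 / 2 : ℝ))
  have h0 := isDivFree_tinyProfile hb y
  have h1 := isDivFree_tinyProfile ha (y - decorCenter b)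
  have h2 := isDivFree_tinyProfile ha (y + decorCenter b)
  simp only [VectorCalculus.divergence] at h0 h1 h2 ⊢
  rw [H.fderiv]
  push_cast
  rw [map_add, map_smul, map_add, h0, h1, h2]
  simp

/-- `U` is even. [folklore] -/
theorem decoratedBlob_neg (b a : ℝ) (y : EuclideanSpace ℝ (Fin 3)) :
    decoratedBlob b a (-y) = decoratedBlob b a y := by
  show tinyProfile b (-y) +
      (1 / 2 : ℝ) • (tinyProfile a (-y - decorCenter b) + tinyProfile a (-y + decorCenter b)) =
    tinyProfile b y + (1 / 2 : ℝ) • (tinyProfile a (y - decorCenter b) + tinyProfile a (y + decorCenter b))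
  rw [tinyProfile_neg, show -y - decorCenter b = -(y + decorCenter b) by abel,
    show -y + decorCenter b = -(y - decorCenter b) by abel, tinyProfile_neg, tinyProfile_neg,
    add_comm (tinyProfile a (y + decorCenter b))]

/-- Near the origin `U` is the carrier. [folklore] -/
theorem decoratedBlob_eventuallyEq (hb : 0 < b) (ha : 0 < a) (h5 : a ≤ 5 / 256) :
    decoratedBlob b a =ᶠ[𝓝 0] tinyProfile b := by
  have hopen : IsOpen {y : EuclideanSpace ℝ (Fin 3) | ‖y‖ < 1 / 2} :=
    isOpen_lt continuous_norm continuous_const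
  filter_upwards [hopen.mem_nhds (show ‖(0 : EuclideanSpace ℝ (Fin 3))‖ < 1 / 2 by simp)] with y hy
  rw [decoratedBlob, mirrorDecor_eq_zero_of_norm_le hb.le ha h5
    (le_of_lt (lt_of_lt_of_le hy (by linarith))), add_zero]

/-- `U(0) = U_b(0)`, of norm `Y₀`. [folklore] -/
theorem decoratedBlob_zero (hb : 0 < b) (ha : 0 < a) (h5 : a ≤ 5 / 256) :
    decoratedBlob b a 0 = tinyProfile b 0 :=
  (decoratedBlob_eventuallyEq hb ha h5).eq_of_nhds

/-- `DU(0) = 0`. [folklore] -/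
theorem fderiv_decoratedBlob_zero (hb : 0 < b) (ha : 0 < a) (h5 : a ≤ 5 / 256) :
    fderiv ℝ (decoratedBlob b a) 0 = 0 := by
  rw [(decoratedBlob_eventuallyEq hb ha h5).fderiv_eq, fderiv_tinyProfile_zero]

/-- `ΔU(0) = 0`. [folklore] -/
theorem laplacian_decoratedBlob_zero (hb : 0 < b) (ha : 0 < a) (h5 : a ≤ 5 / 256) :
    (Δ (decoratedBlob b a)) 0 = 0 := by
  rw [(laplacian_congr_nhds (decoratedBlob_eventuallyEq hb ha h5)).eq_of_nhds,
    laplacian_tinyProfile_zero]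

/-- **Speed ceiling `Y₀`, attained only at the origin.** [folklore] -/
theorem norm_decoratedBlob_le (hb : 0 < b) (ha : 0 < a) (h5 : a ≤ 5 / 256) (y : EuclideanSpace ℝ (Fin 3)) :
    ‖decoratedBlob b a y‖ ≤ TowerRates.wide.Y 0 ∧ (‖decoratedBlob b a y‖ = TowerRates.wide.Y 0 → y = 0) := by
  have hY := Host.wide_Y_zero_pos
  by_cases hplus : ‖y - decorCenter b‖ ≤ 1 / 2
  · rw [decoratedBlob_of_near_plus hb ha h5 hplus, norm_smul, Real.norm_eq_abs,
      abs_of_pos (by norm_num : (0 : ℝ) < 1 / 2)]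
    have := norm_tinyProfile_le ha.ne' (y - decorCenter b)
    exact ⟨by linarith, fun h => by linarith⟩
  by_cases hminus : ‖y + decorCenter b‖ ≤ 1 / 2
  · rw [decoratedBlob_of_near_minus hb ha h5 hminus, norm_smul, Real.norm_eq_abs,
      abs_of_pos (by norm_num : (0 : ℝ) < 1 / 2)]
    have := norm_tinyProfile_le ha.ne' (y + decorCenter b)
    exact ⟨by linarith, fun h => by linarith⟩
  push Not at hplus hminus
  rw [decoratedBlob, mirrorDecor_eq_zero_of_far ha h5 hplus hminus, add_zero]
  exact ⟨norm_tinyProfile_le hb.ne' y, eq_zero_of_norm_tinyProfile_eq hb.ne'⟩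

/-- `U` vanishes off `B̄(0, 2b + 2)`. [folklore] -/
theorem decoratedBlob_eq_zero_of_lt (hb : 0 < b) (ha : 0 < a) (h5 : a ≤ 5 / 256)
    {y : EuclideanSpace ℝ (Fin 3)} (hy : 2 * b + 2 < ‖y‖) : decoratedBlob b a y = 0 := by
  have hp := norm_decorCenter hb.le
  have hplus : 1 / 2 < ‖y - decorCenter b‖ := by
    have := norm_sub_norm_le y (decorCenter b); linarith
  have hminus : 1 / 2 < ‖y + decorCenter b‖ := by
    have := norm_sub_norm_le y (-decorCenter b)
    rw [sub_neg_eq_add, norm_neg] at this; linarith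
  rw [decoratedBlob, mirrorDecor_eq_zero_of_far ha h5 hplus hminus, add_zero, tinyProfile_eq_zero_of_lt hb]
  linarith

/-- `tsupport U ⊆ B̄(0, 2b + 2)`. [folklore] -/
theorem tsupport_decoratedBlob_subset (hb : 0 < b) (ha : 0 < a) (h5 : a ≤ 5 / 256) :
    tsupport (decoratedBlob b a) ⊆ closedBall (0 : EuclideanSpace ℝ (Fin 3)) (2 * b + 2) := by
  refine closure_minimal (fun y hy => ?_) isClosed_closedBall
  rw [mem_closedBall, dist_zero_right]
  by_contra h
  push Not at h
  exact hy (decoratedBlob_eq_zero_of_lt hb ha h5 h)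

/-- `U` has compact support. [folklore] -/
theorem hasCompactSupport_decoratedBlob (hb : 0 < b) (ha : 0 < a) (h5 : a ≤ 5 / 256) :
    HasCompactSupport (decoratedBlob b a) :=
  (isCompact_closedBall (0 : EuclideanSpace ℝ (Fin 3)) (2 * b + 2)).of_isClosed_subset
    (isClosed_tsupport _) (tsupport_decoratedBlob_subset hb ha h5)

/-- **The weak anchor**: the test value at the (unique) argmax is `0`. [cite: MajdaBertozziCUP2002, §1.8 Prop. 1.16] -/
theorem anchor_decoratedBlob (hb : 0 < b) (ha : 0 < a) (h5 : a ≤ 5 / 256) (y : EuclideanSpace ℝ (Fin 3))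
    (hy : ‖decoratedBlob b a y‖ = TowerRates.wide.Y 0) :
    0 ≤ ⟪decoratedBlob b a y, accel 1 (decoratedBlob b a) y⟫ := by
  obtain rfl := (norm_decoratedBlob_le hb ha h5 y).2 hy
  exact inner_accel_nonneg_of_even_flat (contDiff_decoratedBlob b a)
    (hasCompactSupport_decoratedBlob hb ha h5) (isDivFree_decoratedBlob hb.ne' ha.ne')
    (decoratedBlob_neg b a) (fderiv_decoratedBlob_zero hb ha h5) (laplacian_decoratedBlob_zero hb ha h5)

/-- **The strain floor** is read at `p + a y₁` off the `+p` decoration (`a ≤ κ₁/512` pays for the half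
amplitude). [folklore] -/
theorem strain_decoratedBlob (hb : 0 < b) (ha : 0 < a) (h5 : a ≤ 5 / 256) (hκ : a ≤ strainConst / 512) :
    TowerRates.wide.A 0 ≤ ‖fderiv ℝ (decoratedBlob b a) (decorCenter b + a • strainPt)‖ := by
  set y₁ := decorCenter b + a • strainPt with hy₁
  have hn : ‖a • strainPt‖ ≤ 2 * a := by
    rw [norm_smul, Real.norm_eq_abs, abs_of_pos ha]; nlinarith [norm_strainPt_le]
  -- near `y₁` the profile is `½ U_a(· − p)`
  have hev : decoratedBlob b a =ᶠ[𝓝 y₁] fun z => (1 / 2 : ℝ) • tinyProfile a (z - decorCenter b) := by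
    have hopen : IsOpen {z : EuclideanSpace ℝ (Fin 3) | ‖z - decorCenter b‖ < 1 / 2} :=
      isOpen_lt (continuous_id.sub continuous_const).norm continuous_const
    have hmem : y₁ ∈ {z : EuclideanSpace ℝ (Fin 3) | ‖z - decorCenter b‖ < 1 / 2} := by
      simp only [mem_setOf_eq, hy₁, add_sub_cancel_left]; linarith
    filter_upwards [hopen.mem_nhds hmem] with z hz
    exact decoratedBlob_of_near_plus hb ha h5 (le_of_lt hz)
  rw [hev.fderiv_eq, fderiv_fun_const_smul ((contDiff_tinyProfile_comp_sub a _).differentiable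
    (by simp) y₁), fderiv_tinyProfile_comp_sub, hy₁, add_sub_cancel_left, norm_smul, Real.norm_eq_abs,
    abs_of_pos (by norm_num : (0 : ℝ) < 1 / 2), norm_fderiv_tinyProfile_strainPt ha,
    Host.wide_A_zero_eq, Host.wide_N_zero]
  have hY := TowerRates.Y_pos TowerRates.wide 0
  rw [le_div_iff₀ (by norm_num : (0 : ℝ) < 512)] at hκ
  have hq : 512 ≤ strainConst / a := by rw [le_div_iff₀ ha]; linarith
  nlinarith

/-- **The core loop** is ecbridge-4's tiny loop with winding `m = ⌈1/(32a)⌉`, translated to `+p`.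
[folklore] -/
theorem core_decoratedBlob (hb : 0 < b) (ha : 0 < a) (h5 : a ≤ 5 / 256) :
    ∃ (x : EuclideanSpace ℝ (Fin 3)) (γ : ℝ → EuclideanSpace ℝ (Fin 3)),
      ‖x‖ ≤ 2 * b + 2 ∧ ContDiff ℝ 1 γ ∧ γ 0 = γ 1 ∧
        (∀ s ∈ Icc (0 : ℝ) 1, γ s ∈ closedBall x (1 / TowerRates.wide.N 0)) ∧
        (∀ s ∈ Icc (0 : ℝ) 1, ‖deriv γ s‖ ≤ 8 * Real.pi / TowerRates.wide.N 0) ∧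
        TowerRates.wide.N 0 ^ (TowerRates.wide.β - 2) ≤ circulation (decoratedBlob b a) γ := by
  have ha2 : 0 < a / 2 := by positivity
  set m := windings (a / 2) with hm
  have hm0 : 0 < m := windings_pos ha2
  have hm1 : 1 / 32 ≤ a * m := by have := le_mul_windings ha2; rw [← hm] at this; linarith
  have hm2 : a * m ≤ 1 / 32 + a := by have := mul_windings_le ha2; rw [← hm] at this; linarith
  have hp := norm_decorCenter hb.le
  refine ⟨decorCenter b + (a * lc) • e₁, fun s => decorCenter b + tinyLoop a m s, ?_, ?_, ?_,
    fun s _ => ?_, fun s _ => ?_, ?_⟩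
  · have h1 := norm_add_le (decorCenter b) ((a * lc) • e₁)
    rw [norm_center ha.le] at h1
    have h2 : a * lc ≤ 1 := by rw [lc]; linarith
    linarith
  · exact contDiff_const.add (contDiff_tinyLoop _ _)
  · simp only [tinyLoop_zero_eq_one]
  · rw [mem_closedBall, dist_eq_norm, add_sub_add_left_eq_sub, norm_tinyLoop_sub_center ha.le,
      Host.wide_N_zero, lr]
    linarith
  · have hd : deriv (fun s => decorCenter b + tinyLoop a m s) s = tinyLoopVel a m s := by
      rw [deriv_const_add', deriv_tinyLoop]
    rw [hd, norm_tinyLoopVel ha.le, Host.wide_N_zero, lr]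
    have hπ := Real.pi_pos
    have : 2 * π * (m : ℝ) * (a * (1 / 5)) = (2 * π / 5) * (a * m) := by ring
    rw [this, div_eq_mul_inv (8 * π)]
    nlinarith
  · -- the circulation is half that of `U_a` around the tiny loop
    have hloop : ∀ s : ℝ, ‖tinyLoop a m s‖ ≤ 1 / 2 := by
      intro s
      have h1 := norm_add_le (tinyLoop a m s - (a * lc) • e₁) ((a * lc) • e₁)
      rw [sub_add_cancel, norm_tinyLoop_sub_center ha.le, norm_center ha.le, lr, lc] at h1
      linarith
    have hc : circulation (decoratedBlob b a) (fun s => decorCenter b + tinyLoop a m s) =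
        circulation (fun y => (1 / 2 * TowerRates.wide.Y 0) • tinyBlob a y) (tinyLoop a m) := by
      unfold circulation
      refine intervalIntegral.integral_congr fun s _ => ?_
      have hd : deriv (fun s => decorCenter b + tinyLoop a m s) s = deriv (tinyLoop a m) s := by
        rw [deriv_const_add', deriv_tinyLoop]
      simp only [hd]
      rw [decoratedBlob_of_near_plus hb ha h5 (by rw [add_sub_cancel_left]; exact hloop s),
        add_sub_cancel_left, tinyProfile, smul_smul]
    rw [hc, circulation_const_smul, Host.wide_rpow_β_sub_two, Host.wide_N_zero]
    have hcirc := circulation_tinyBlob_tinyLoop_ge ha hm0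
    have hY := TowerRates.Y_pos TowerRates.wide 0
    rw [div_eq_mul_one_div]
    have h7 : 1 / 256 ≤ 1 / 2 * (7 / 20 * (a * m)) := by nlinarith
    calc TowerRates.wide.Y 0 * (1 / 256) ≤ TowerRates.wide.Y 0 * (1 / 2 * (7 / 20 * (a * m))) :=
        mul_le_mul_of_nonneg_left h7 hY.le
      _ = 1 / 2 * TowerRates.wide.Y 0 * (7 / 20 * (a * m)) := by ring
      _ ≤ 1 / 2 * TowerRates.wide.Y 0 * circulation (tinyBlob a) (tinyLoop a m) :=
        mul_le_mul_of_nonneg_left hcirc (by positivity)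

end Blob

end Summit.NavierStokesRegularity.FluidComputer.PalasekTowerClayBridge.Germ

end
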